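import Mathlib.Analysis.Complex.ExponentialBounds
import Mathlib.Tactic.IntervalCases
import Literature.Computability.Complexity.FPRAS
import Literature.Computability.Complexity.FPRASTransfer
import HarnessLib

/-!
# `#BIS`-hardness of counting independent sets in bounded-degree bipartite graphs (Cai et al. 2016)

The `λ = 1` (independent-set counting) content of the `#BIS`-hardness theorem of
Cai–Galanis–Goldberg–Guo–Jerrum–Štefankovič–Vigoda for the hard-core model on bipartite graphs of
bounded degree, vendored as a named fact in the FPRAS-transfer form consumed by the route
`Summits/PneNP/PneNP/Theses/BISOrderDimension.lean`, together with Kelly's critical activity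
`λ_c(Δ) = (Δ−1)^{Δ−1}/(Δ−2)^{Δ}` and the (proved) arithmetic locating `λ = 1` relative to it:
`λ_c(Δ) < 1` iff `Δ ≥ 6` (for `Δ ≥ 3`).

Sources.

* J.-Y. Cai, A. Galanis, L. A. Goldberg, H. Guo, M. Jerrum, D. Štefankovič, E. Vigoda,
  *#BIS-hardness for 2-spin systems on bipartite bounded degree graphs in the tree
  non-uniqueness region*, J. Comput. System Sci. 82 (2016) 690–711,
  doi:10.1016/j.jcss.2015.11.009 (`CaiEtAl2016`; conference version *Approximating the partition
  function of two-spin systems on bipartite graphs*, APPROX-RANDOM 2014, arXiv:1311.4451, whose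
  numbering and pages we quote). §1, p. 5: "For the hard-core model (i.e., `β = 0` and `γ = 1`)
  Kelly [Kel85] showed that non-uniqueness holds on `𝕋_Δ` if and only if
  `λ > λ_c(Δ) = (Δ−1)^{Δ−1}/(Δ−2)^{Δ}`. As a consequence we get the following corollary for the
  hard-core model. **Corollary 3.** For all `Δ ≥ 3`, all `λ > λ_c(Δ) = (Δ−1)^{Δ−1}/(Δ−2)^{Δ}`, it
  is #BIS-hard to approximate the partition function of the hard-core model on bipartite graphs
  of maximum degree `Δ`." §2, p. 6: the problem `Bi-2-Spin(β,γ,λ,Δ)` — "Instance. A bipartite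
  (multi)graph `B = (V,E)` with degree bound `Δ`. Output. The quantity
  `Z_B(β,γ,λ) = ∑_{σ : V → {0,1}} λ^{∑_v σ(v)} ∏_{(v,u) ∈ E} β^{(1−σ(v))(1−σ(u))} γ^{σ(v)σ(u)}`" —,
  the problem `#BIS` ("Instance. A bipartite graph `B`. Output. The number of independent sets in
  `B`"), FPRAS and AP-reductions `f ≤_AP g` after Dyer–Goldberg–Greenhill–Jerrum; "#BIS-hard"
  means `#BIS ≤_AP ·`.
* M. Dyer, L. A. Goldberg, C. Greenhill, M. Jerrum, *The relative complexity of approximate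
  counting problems*, Algorithmica 38 (2003) 471–500 (`DyerEtAl2003`), §1: FPRAS and AP-reductions
  (conditions (i)–(iii), quoted in `FPRAS.lean`), problem `#BIS`.

## Tree form

* `hardCoreCriticalActivity Δ = ((Δ : ℝ) − 1)^{Δ−1} / ((Δ : ℝ) − 2)^{Δ}` (meaningful for `Δ ≥ 3`;
  at `Δ ≤ 2` the value is a junk real number nobody uses). Proved: `λ_c(6) = 3125/4096`,
  `1 < λ_c(Δ)` for `3 ≤ Δ ≤ 5`, `λ_c(Δ) < 1` for `Δ ≥ 6` — so at activity `λ = 1` the hypothesis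
  `λ > λ_c(Δ)` of Corollary 3 holds exactly for `Δ ≥ 6`.
* At `(β,γ,λ) = (0,1,1)` the partition function `Z_B(0,1,1)` is the number of independent sets of
  `B`, so `Bi-2-Spin(0,1,1,Δ)` is `#BIS` restricted to bipartite graphs of maximum degree `≤ Δ`:
  the tree's `bisCountMaxDeg Δ` (`FPRAS.lean`; graphs violating the degree bound, non-bipartite
  graphs and non-code-words count `0`), and `#BIS` is `bisCount`.
* `CaiEtAl2016_bisMaxDeg_hard : Prop := ∀ Δ ≥ 6, HasFPRAS (bisCountMaxDeg Δ) → HasFPRAS bisCount`.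
  The printed conclusion is the AP-reduction `#BIS ≤_AP Bi-2-Spin(0,1,1,Δ)`; the fact records its
  defining consequence — an FPRAS for the target problem, plugged in as the oracle of the reduction
  (DGGJ conditions (i)–(iii)), is an FPRAS for `#BIS` — in the tree's FPRAS shape `HasFPRAS`, which
  is what the route consumes (`CaiEtAl2016_bisMaxDeg_hard.six` is definitionally the inlined
  hypothesis of `Summit.PneNP.PneNP.Theses.BISOrderDimension.DimSixtyFourBISHard`). This is WEAKER
  than the printed statement. The tree's `APReducible` (`FPRAS.lean`) is a transcript-model rendering
  of `≤_AP` whose transfer lemma `APReducible N N' → HasFPRAS N' → HasFPRAS N` is not yet in the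
  tree; `CaiEtAl2016_bisMaxDeg_hard_of_apReducible` records that the fact follows from the
  AP-reduction form plus that transfer lemma (both as hypotheses), which is the intended discharge.
  UPDATE (2026-08-15): the transfer lemma is now PROVED in the tree (`HasFPRAS.of_apReducible`,
  `FPRASTransfer.lean`); `CaiEtAl2016_bisMaxDeg_hard_of_apReducible'` takes only the printed
  AP-reductions `∀ Δ ≥ 6, #BIS ≤_AP #BIS↾(maxdeg ≤ Δ)` as hypothesis, and
  `hasFPRAS_bisCount_of_apReducible` is the pointwise form. What remains for a discharge is
  Cai et al.'s Thm 2 / Cor. 3 proper (the Sly gadget, Lemma 9, and the gadget reductions Lemmas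
  8, 11–13) rendered as transcript-model oracle machines.

What is NOT here: the general Corollary 3 (real activities `λ`, real-valued partition functions —
the tree's approximate counters are `ℕ`-valued), Theorems 1–2 (general antiferromagnetic 2-spin
systems), and the proof (nearly-independent phase-correlated spins, unary symmetry breaking).
-/

namespace Literature.Computability.Complexity

open _root_.Computability

/-! ### Kelly's critical activity and the position of `λ = 1` -/

/-- **The critical activity of the hard-core model on the infinite `Δ`-regular tree**,
`λ_c(Δ) = (Δ−1)^{Δ−1}/(Δ−2)^{Δ}` (Kelly 1985): "non-uniqueness holds on `𝕋_Δ` if and only if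
`λ > λ_c(Δ)`". Real subtraction in the bases; meaningful for `Δ ≥ 3` (for `Δ ≤ 2` a junk value).
[cite: CaiEtAl2016, §1 (arXiv:1311.4451 p. 5, before Cor. 3; after Kelly 1985)] -/
noncomputable def hardCoreCriticalActivity (Δ : ℕ) : ℝ :=
  ((Δ : ℝ) - 1) ^ (Δ - 1) / ((Δ : ℝ) - 2) ^ Δ

/-- `λ_c(6) = 5⁵/4⁶ = 3125/4096`. [cite: CaiEtAl2016, Cor. 3 (formula for λ_c)] -/
theorem hardCoreCriticalActivity_six : hardCoreCriticalActivity 6 = 3125 / 4096 := by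
  norm_num [hardCoreCriticalActivity]

/-- `λ_c(5) = 4⁴/3⁵ = 256/243`. [cite: CaiEtAl2016, Cor. 3 (formula for λ_c)] -/
theorem hardCoreCriticalActivity_five : hardCoreCriticalActivity 5 = 256 / 243 := by
  norm_num [hardCoreCriticalActivity]

/-- For `3 ≤ Δ ≤ 5` the activity `λ = 1` is below the critical activity: `1 < λ_c(Δ)`
(`λ_c(3) = 4`, `λ_c(4) = 27/16`, `λ_c(5) = 256/243`). [folklore] -/
theorem one_lt_hardCoreCriticalActivity {Δ : ℕ} (h3 : 3 ≤ Δ) (h5 : Δ ≤ 5) :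
    1 < hardCoreCriticalActivity Δ := by
  interval_cases Δ <;> norm_num [hardCoreCriticalActivity]

/-- `exp (5/4) < 4` (since `5/4 < 2 log 2 = 1.386…`). [folklore] -/
private theorem exp_five_fourths_lt_four : Real.exp (5 / 4) < 4 := by
  have h4 : Real.exp (2 * Real.log 2) = 4 := by
    rw [two_mul, Real.exp_add, Real.exp_log two_pos]
    norm_num
  calc Real.exp (5 / 4) < Real.exp (2 * Real.log 2) :=
        Real.exp_lt_exp.2 (by linarith [Real.log_two_gt_d9])
    _ = 4 := h4

/-- For `Δ ≥ 6` the activity `λ = 1` is above the critical activity: `λ_c(Δ) < 1`, i.e.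
`(Δ−1)^{Δ−1} < (Δ−2)^{Δ}`; with `d = Δ − 2 ≥ 4`, `(1 + 1/d)^{d+1} ≤ e^{(d+1)/d} ≤ e^{5/4} < 4 ≤ d`.
So Corollary 3 of Cai et al. applies at `λ = 1` exactly when `Δ ≥ 6`. [folklore] -/
theorem hardCoreCriticalActivity_lt_one {Δ : ℕ} (h6 : 6 ≤ Δ) : hardCoreCriticalActivity Δ < 1 := by
  obtain ⟨d, rfl⟩ : ∃ d, Δ = d + 2 := ⟨Δ - 2, by omega⟩
  have hd4 : (4 : ℝ) ≤ d := by exact_mod_cast (by omega : 4 ≤ d)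
  have hd0 : (0 : ℝ) < d := by linarith
  unfold hardCoreCriticalActivity
  have e1 : ((d + 2 : ℕ) : ℝ) - 1 = (d : ℝ) + 1 := by push_cast; ring
  have e2 : ((d + 2 : ℕ) : ℝ) - 2 = (d : ℝ) := by push_cast; ring
  have e3 : d + 2 - 1 = d + 1 := by omega
  rw [e1, e2, e3, div_lt_one (by positivity)]
  -- goal: (d + 1) ^ (d + 1) < d ^ (d + 2)
  have hgrowth : (1 + 1 / (d : ℝ)) ^ (d + 1) ≤ Real.exp (5 / 4) := by
    calc (1 + 1 / (d : ℝ)) ^ (d + 1) ≤ (Real.exp (1 / d)) ^ (d + 1) := by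
            gcongr
            linarith [Real.add_one_le_exp (1 / (d : ℝ))]
      _ = Real.exp (((d + 1 : ℕ) : ℝ) * (1 / d)) := (Real.exp_nat_mul _ _).symm
      _ ≤ Real.exp (5 / 4) := by
            apply Real.exp_le_exp.2
            have hq : 1 / (d : ℝ) ≤ 1 / 4 := one_div_le_one_div_of_le (by norm_num) hd4
            have hprod : ((d + 1 : ℕ) : ℝ) * (1 / d) = 1 + 1 / d := by
              push_cast
              field_simp
            linarith
  have hsplit : ((d : ℝ) + 1) ^ (d + 1) = (d : ℝ) ^ (d + 1) * (1 + 1 / d) ^ (d + 1) := by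
    rw [← mul_pow]
    congr 1
    field_simp
  calc ((d : ℝ) + 1) ^ (d + 1) = (d : ℝ) ^ (d + 1) * (1 + 1 / d) ^ (d + 1) := hsplit
    _ ≤ (d : ℝ) ^ (d + 1) * Real.exp (5 / 4) := by gcongr
    _ < (d : ℝ) ^ (d + 1) * 4 := by gcongr; exact exp_five_fourths_lt_four
    _ ≤ (d : ℝ) ^ (d + 1) * d := by gcongr
    _ = (d : ℝ) ^ (d + 2) := by ring

/-- Summary: for `Δ ≥ 3`, `λ_c(Δ) < 1 ↔ 6 ≤ Δ`. [folklore] -/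
theorem hardCoreCriticalActivity_lt_one_iff {Δ : ℕ} (h3 : 3 ≤ Δ) :
    hardCoreCriticalActivity Δ < 1 ↔ 6 ≤ Δ := by
  refine ⟨fun h => ?_, hardCoreCriticalActivity_lt_one⟩
  by_contra h6
  exact absurd h (not_lt.2 (one_lt_hardCoreCriticalActivity h3 (by omega)).le)

/-! ### `#BIS` on bounded-degree instances: restriction lemmas -/

/-- On graphs satisfying the degree bound the restricted count `bisCountMaxDeg Δ` is the `#BIS` count.
[folklore] -/
theorem bisCountMaxDeg_encode_of_degree_le {Δ n : ℕ} {G : SimpleGraph (Fin n)}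
    (hΔ : ∀ v : Fin n, Set.ncard {w : Fin n | G.Adj v w} ≤ Δ) :
    bisCountMaxDeg Δ (encodingGraph.encode ⟨n, G⟩) = bisCount (encodingGraph.encode ⟨n, G⟩) := by
  rw [bisCountMaxDeg_encode, bisCount_encode]
  congr 1
  ext S
  simp only [Set.mem_setOf_eq]
  exact ⟨fun h => ⟨h.1, h.2.2⟩, fun h => ⟨h.1, hΔ, h.2⟩⟩

/-- On graphs violating the degree bound the restricted count is `0`. [folklore] -/
theorem bisCountMaxDeg_encode_of_not_degree_le {Δ n : ℕ} {G : SimpleGraph (Fin n)}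
    (hΔ : ¬ ∀ v : Fin n, Set.ncard {w : Fin n | G.Adj v w} ≤ Δ) :
    bisCountMaxDeg Δ (encodingGraph.encode ⟨n, G⟩) = 0 := by
  rw [bisCountMaxDeg_encode]
  have : {S : Finset (Fin n) | G.Colorable 2 ∧
      (∀ v : Fin n, Set.ncard {w : Fin n | G.Adj v w} ≤ Δ) ∧
      ∀ a ∈ S, ∀ b ∈ S, ¬ G.Adj a b} = ∅ := by
    ext S
    simp only [Set.mem_setOf_eq, Set.mem_empty_iff_false, iff_false, not_and]
    exact fun _ h => absurd h hΔ
  rw [this, Set.ncard_empty]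

/-- The restricted counts are compatible: for `Δ ≤ Δ'`, on a graph of maximum degree `≤ Δ` the counts
`bisCountMaxDeg Δ'` and `bisCountMaxDeg Δ` agree (both are the `#BIS` count). [folklore] -/
theorem bisCountMaxDeg_encode_mono {Δ Δ' n : ℕ} (hΔΔ' : Δ ≤ Δ') {G : SimpleGraph (Fin n)}
    (hΔ : ∀ v : Fin n, Set.ncard {w : Fin n | G.Adj v w} ≤ Δ) :
    bisCountMaxDeg Δ' (encodingGraph.encode ⟨n, G⟩) =
      bisCountMaxDeg Δ (encodingGraph.encode ⟨n, G⟩) := by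
  rw [bisCountMaxDeg_encode_of_degree_le hΔ,
    bisCountMaxDeg_encode_of_degree_le fun v => (hΔ v).trans hΔΔ']

/-- Undecodable words count `0` for both problems. [folklore] -/
theorem bisCountMaxDeg_of_decode_eq_none {y : List Bool} (hy : encodingGraph.decode y = none)
    (Δ : ℕ) : bisCountMaxDeg Δ y = 0 ∧ bisCount y = 0 := by
  simp [bisCount, bisCountMaxDeg, hy]

/-! ### Cai et al. 2016, Corollary 3 at activity `λ = 1` -/

/-- **Cai–Galanis–Goldberg–Guo–Jerrum–Štefankovič–Vigoda 2016, Corollary 3, at activity `λ = 1`: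
for every `Δ ≥ 6`, `#BIS` restricted to bipartite graphs of maximum degree `Δ` is `#BIS`-hard.**
Printed: "For all `Δ ≥ 3`, all `λ > λ_c(Δ) = (Δ−1)^{Δ−1}/(Δ−2)^{Δ}`, it is #BIS-hard to approximate
the partition function of the hard-core model on bipartite graphs of maximum degree `Δ`" — i.e.
`#BIS ≤_AP Bi-2-Spin(0,1,λ,Δ)`. At `λ = 1` the hard-core partition function `Z_B(0,1,1)` is the number
of independent sets of `B` (`bisCountMaxDeg Δ`), and `1 > λ_c(Δ)` holds iff `Δ ≥ 6`
(`hardCoreCriticalActivity_lt_one_iff`). Vendored through the defining consequence of an AP-reduction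
(DGGJ conditions (i)–(iii): an FPRAS for the oracle problem makes the reduction an FPRAS for the
source problem) in the tree's FPRAS shape `HasFPRAS`: an FPRAS for `#BIS` on bipartite graphs all of
whose degrees are `≤ Δ` yields an FPRAS for `#BIS`. WEAKER than the printed AP-reducibility; the
`Δ = 6` instance is the hypothesis of the route item
`Summit.PneNP.PneNP.Theses.BISOrderDimension.DimSixtyFourBISHard` (`CaiEtAl2016_bisMaxDeg_hard.six`).
Not in Mathlib; stated as a `Prop`.
[cite: CaiEtAl2016, Cor. 3 (arXiv:1311.4451 p. 5) at λ = 1, with §2 (Bi-2-Spin, #BIS, ≤_AP; p. 6)] -/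
def CaiEtAl2016_bisMaxDeg_hard : Prop :=
  ∀ Δ : ℕ, 6 ≤ Δ → HasFPRAS (bisCountMaxDeg Δ) → HasFPRAS bisCount

/-- **Corollary 3 of Cai et al. at `λ = 1`, `Δ = 6`** (`λ = 1 > λ_c(6) = 3125/4096`), in the inlined
FPRAS shape of the route `Summits/PneNP/PneNP/Theses/BISOrderDimension.lean`: an FPRAS for counting
independent sets of 2-colourable graphs all of whose degrees are `≤ 6` yields an FPRAS for `#BIS`.
Definitionally the hypothesis of the support item `DimSixtyFourBISHard` of that route.
[cite: CaiEtAl2016, Cor. 3 (Δ = 6, λ = 1; arXiv:1311.4451 p. 5)] -/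
theorem CaiEtAl2016_bisMaxDeg_hard.six (h : CaiEtAl2016_bisMaxDeg_hard) :
    (∃ F ∈ FP, ∃ c : Polynomial ℕ, ∀ (x : List Bool) (kη kδ : ℕ), 0 < kη → 0 < kδ →
      uniformProb (c.eval (x.length + kη + kδ)) {u | ¬ IsApproxCount kη
        ((fun y : List Bool => (encodingGraph.decode y).elim 0 fun G =>
          Set.ncard {S : Finset (Fin G.1) | G.2.Colorable 2 ∧
            (∀ v : Fin G.1, Set.ncard {w : Fin G.1 | G.2.Adj v w} ≤ 6) ∧
            ∀ a ∈ S, ∀ b ∈ S, ¬ G.2.Adj a b}) x)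
        (countEstimate F x 0 kη kδ u)} ≤ 1 / (kδ : ℝ)) →
    (∃ F ∈ FP, ∃ c : Polynomial ℕ, ∀ (x : List Bool) (kη kδ : ℕ), 0 < kη → 0 < kδ →
      uniformProb (c.eval (x.length + kη + kδ)) {u | ¬ IsApproxCount kη
        ((fun y : List Bool => (encodingGraph.decode y).elim 0 fun G =>
          Set.ncard {S : Finset (Fin G.1) | G.2.Colorable 2 ∧ ∀ a ∈ S, ∀ b ∈ S, ¬ G.2.Adj a b}) x)
        (countEstimate F x 0 kη kδ u)} ≤ 1 / (kδ : ℝ)) :=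
  h 6 le_rfl

/-- The `Δ = 6` instance with the named notions: `HasFPRAS (bisCountMaxDeg 6) → HasFPRAS bisCount`.
[cite: CaiEtAl2016, Cor. 3 (Δ = 6, λ = 1; arXiv:1311.4451 p. 5)] -/
theorem CaiEtAl2016_bisMaxDeg_hard.hasFPRAS_six (h : CaiEtAl2016_bisMaxDeg_hard) :
    HasFPRAS (bisCountMaxDeg 6) → HasFPRAS bisCount :=
  h 6 le_rfl

/-- **Discharge route.** The fact follows from the printed AP-reductions
`#BIS ≤_AP (#BIS on bipartite graphs of maximum degree Δ)`, `Δ ≥ 6`, rendered with the tree's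
`APReducible`, together with the transfer lemma "an AP-reduction pulls an FPRAS back" (DGGJ §1;
the tree's `HasFPRAS.of_apReducible`, to be proved in the sequel of `FPRAS.lean`) — both taken as
hypotheses here. [cite: DyerEtAl2003, §1 (AP-reductions, conditions (i)–(iii))] -/
theorem CaiEtAl2016_bisMaxDeg_hard_of_apReducible
    (hred : ∀ Δ : ℕ, 6 ≤ Δ → APReducible bisCount (bisCountMaxDeg Δ))
    (htransfer : ∀ N N' : List Bool → ℕ, APReducible N N' → HasFPRAS N' → HasFPRAS N) :
    CaiEtAl2016_bisMaxDeg_hard :=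
  fun Δ hΔ hF => htransfer _ _ (hred Δ hΔ) hF


/-- **Discharge route, transfer half done.** With the FPRAS transfer along AP-reductions now in the tree
(`HasFPRAS.of_apReducible`, `FPRASTransfer.lean`; Dyer–Goldberg–Greenhill–Jerrum 2003 §1), the fact is
implied by the printed AP-reductions ALONE: Corollary 3 at `λ = 1` in its own shape,
`∀ Δ ≥ 6, #BIS ≤_AP (#BIS on bipartite graphs of maximum degree Δ)`, rendered with the tree's
`APReducible`. (The remaining hypothesis is Cai et al.'s theorem proper — the Sly gadget and the gadget
reductions — not a weakening of it.)
[cite: CaiEtAl2016, Cor. 3 (arXiv:1311.4451 p. 5) at λ = 1; with DyerEtAl2003 §1 (AP-reductions transfer FPRASes)] -/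
theorem CaiEtAl2016_bisMaxDeg_hard_of_apReducible'
    (hred : ∀ Δ : ℕ, 6 ≤ Δ → APReducible bisCount (bisCountMaxDeg Δ)) : CaiEtAl2016_bisMaxDeg_hard :=
  CaiEtAl2016_bisMaxDeg_hard_of_apReducible hred fun _ _ h hF => HasFPRAS.of_apReducible h hF

/-- Pointwise form: an AP-reduction `#BIS ≤_AP #BIS↾(maxdeg ≤ Δ)` and an FPRAS for the bounded-degree
problem give an FPRAS for `#BIS` (any `Δ`; Cai et al. supply the reduction for `Δ ≥ 6`).
[cite: DyerEtAl2003, §1 (AP-reductions transfer FPRASes)] -/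
theorem hasFPRAS_bisCount_of_apReducible {Δ : ℕ} (hred : APReducible bisCount (bisCountMaxDeg Δ))
    (hF : HasFPRAS (bisCountMaxDeg Δ)) : HasFPRAS bisCount :=
  HasFPRAS.of_apReducible hred hF

/-- Contrapositive pointwise form (the hardness reading): if `#BIS` has no FPRAS and
`#BIS ≤_AP #BIS↾(maxdeg ≤ Δ)`, then the bounded-degree problem has no FPRAS either.
[cite: DyerEtAl2003, §1] -/
theorem not_hasFPRAS_bisCountMaxDeg_of_apReducible {Δ : ℕ} (hred : APReducible bisCount (bisCountMaxDeg Δ))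
    (h : ¬ HasFPRAS bisCount) : ¬ HasFPRAS (bisCountMaxDeg Δ) :=
  hred.not_hasFPRAS h

end Literature.Computability.Complexity
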